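import Summits.CriticalPhenomena.PercolationContinuityZ3.Theorems.PercNearOneGluingNoHeavyLowerTailSahiHubTwoLevelSquare
import Mathlib.Tactic.Linarith
import Mathlib.Tactic.Positivity
import Mathlib.Tactic.Ring
import HarnessLib

/-!
# `NoHeavyLowerTail` (crux stmt-CriticalPhenomena-4575), P2 — THE `(2,2)` ATOM: SETTING, CORNER ATOMS AND THE BOX IDENTITY WITH POINT-DEPENDENT `h`

Seat `prim-masterthm-p2`, gen 29 (memo `FROM-prim-masterthm-p2-g29-SQUARE-IDENTITY.md` §8–§9; `--supports stmt-CriticalPhenomena-4575`).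
No `sorry`, no named facts, standard axioms.

SETTING.  The `(2,2)` atom of the crossed-positivity programme: `f(z₁,z₂,a)`, `g(z₁,z₂,b)`, `h(z₁,z₂,a,b)` with `(z₁,z₂) ∈ Fin 2 × Fin 2`
(two coordinates essential to ALL THREE functions), `a ∈ α` (weight `wA`), `b ∈ β` (weight `wB`).  Square points `x = (z₁,z₂)`:
`0=(0,0), Z=(1,0), C=(0,1), T=(1,1)`, antipode `x̄ = (1−z₁,1−z₂)`.  Fibre data at `b`: `Y_x(b) = Σ_a wA f_x h_x(·,b)` (`Ysl2`),
`H_x(b) = Σ_a wA h_x(·,b)` (`Hsl2`) — NOW INDEXED BY THE POINT; averages `Ȳ_x` (`Ybar2`), `H̄_x` (`Hb2`), `F_x = Fm`, `G_x = gm` (tree).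
CORNER ATOMS (memo §8, closed form verified exactly): `atom_κ = Main − Hpart_κ`, `Main = Σ_x [2E(g_xY_x) − F_x̄E(g_xH_x) − G_x̄Ȳ_x]`,
`χ = (F_T−F_0)(G_T−G_0) + (F_Z−F_C)(G_Z−G_C)`, `κ_xy = (F_x−F_y)(G_x−G_y)`,
`Hpart_11 = χH̄_T − κ_TZ(H̄_T−H̄_C) − κ_TC(H̄_T−H̄_Z)`, `Hpart_10 = χH̄_Z + κ_Z0(H̄_T−H̄_Z) − κ_TZ(H̄_Z−H̄_0)`, `Hpart_01` = its mirror,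
`Hpart_00 = χH̄_0 + κ_Z0(H̄_C−H̄_0) + κ_C0(H̄_Z−H̄_0)`; the bicubic `E₃(t₁,t₂)` of the triple is a nonnegative combination of these
atoms, edge atoms and point atoms (Bernstein expansion, memo §9 — separate file).
THIS FILE: the definitions; **the box identity `Main = Σ_b wB·S^ρ(b) + CP(ρ) + Σ_x ρ_x(G_x−G_x̄)Ȳ_x` for every `ρ`** (`main_eq_square`),
with `S^ρ(b) = Σ_x g_x(b)[(2−ρ_x)Y_x − F_x̄H_x − (1−ρ_x̄)Y_x̄]` (`Sbox2`) and `CP = Σ_x[ρ_xCov_b(g_x,Y_x) + (1−ρ_x)Cov_b(g_x̄,Y_x)]` (`CPart2`);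
the remainder of each corner in the `D_T0/D_ZC` form of `…SahiT2SquareRemainders` (`R11_eq` … `R00_eq`); `CPart2 ≥ 0` for
`ρ ∈ [0,1]⁴` (FKG on `β`); the fibre facts `Y_x ≥ F_xH_x`, monotonicity of `Y, H, Ȳ, H̄` on the square. [this work]
-/

noncomputable section

open scoped Classical

namespace Summit.CriticalPhenomena.PercolationContinuityZ3.Theorems

namespace SahiT2Square

open Finset Literature.Combinatorics.Sahi2008
open SahiTriangleSupermodular (fkg_sum)
open SahiHubTwoLevel (Fm gm)

section Defs

variable {α β : Type} [Fintype α] [Fintype β]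
  (wA : α → ℝ) (wB : β → ℝ) (f : Fin 2 → Fin 2 → α → ℝ) (g : Fin 2 → Fin 2 → β → ℝ) (h : Fin 2 → Fin 2 → α → β → ℝ)

/-- `Y_x(b) = Σ_a wA(a) f_x(a) h_x(a,b)` at the square point `x = (z₁,z₂)`. -/
def Ysl2 (z₁ z₂ : Fin 2) (b : β) : ℝ := ∑ a, wA a * (f z₁ z₂ a * h z₁ z₂ a b)
/-- `H_x(b) = Σ_a wA(a) h_x(a,b)`. -/
def Hsl2 (z₁ z₂ : Fin 2) (b : β) : ℝ := ∑ a, wA a * h z₁ z₂ a b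
/-- `Ȳ_x = Σ_b wB Y_x(b)`. -/
def Ybar2 (z₁ z₂ : Fin 2) : ℝ := ∑ b, wB b * Ysl2 wA f h z₁ z₂ b
/-- `H̄_x = Σ_b wB H_x(b)`. -/
def Hb2 (z₁ z₂ : Fin 2) : ℝ := ∑ b, wB b * Hsl2 wA h z₁ z₂ b
/-- mixed moment `E_b[g_x Y_y]`. -/
def M2 (z₁ z₂ y₁ y₂ : Fin 2) : ℝ := ∑ b, wB b * (g z₁ z₂ b * Ysl2 wA f h y₁ y₂ b)
/-- mixed moment `E_b[g_x H_x]` (same point). -/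
def N2 (z₁ z₂ : Fin 2) : ℝ := ∑ b, wB b * (g z₁ z₂ b * Hsl2 wA h z₁ z₂ b)
/-- `Cov_b(g_x, Y_y)`. -/
def cov2 (z₁ z₂ y₁ y₂ : Fin 2) : ℝ := M2 wA wB f g h z₁ z₂ y₁ y₂ - gm wB g z₁ z₂ * Ybar2 wA wB f h y₁ y₂

/-- `Main = Σ_x [2E(g_xY_x) − F_x̄·E(g_xH_x) − G_x̄·Ȳ_x]` (corner-independent part of every atom). -/
def Main : ℝ :=
  (2 * M2 wA wB f g h 1 1 1 1 - Fm wA f 0 0 * N2 wA wB g h 1 1 - gm wB g 0 0 * Ybar2 wA wB f h 1 1)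
  + (2 * M2 wA wB f g h 1 0 1 0 - Fm wA f 0 1 * N2 wA wB g h 1 0 - gm wB g 0 1 * Ybar2 wA wB f h 1 0)
  + (2 * M2 wA wB f g h 0 1 0 1 - Fm wA f 1 0 * N2 wA wB g h 0 1 - gm wB g 1 0 * Ybar2 wA wB f h 0 1)
  + (2 * M2 wA wB f g h 0 0 0 0 - Fm wA f 1 1 * N2 wA wB g h 0 0 - gm wB g 1 1 * Ybar2 wA wB f h 0 0)

/-- `κ_xy = (F_x − F_y)(G_x − G_y)`. -/
def kap (z₁ z₂ y₁ y₂ : Fin 2) : ℝ := (Fm wA f z₁ z₂ - Fm wA f y₁ y₂) * (gm wB g z₁ z₂ - gm wB g y₁ y₂)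
/-- `χ = κ_{T0} + κ_{ZC}` (the antipodal couplings). -/
def chi : ℝ := kap wA wB f g 1 1 0 0 + kap wA wB f g 1 0 0 1

/-- `Hpart` at the corner `(1,1)`. -/
def Hpart11 : ℝ := chi wA wB f g * Hb2 wA wB h 1 1 - kap wA wB f g 1 1 1 0 * (Hb2 wA wB h 1 1 - Hb2 wA wB h 0 1)
  - kap wA wB f g 1 1 0 1 * (Hb2 wA wB h 1 1 - Hb2 wA wB h 1 0)
/-- `Hpart` at the corner `(1,0)`. -/
def Hpart10 : ℝ := chi wA wB f g * Hb2 wA wB h 1 0 + kap wA wB f g 1 0 0 0 * (Hb2 wA wB h 1 1 - Hb2 wA wB h 1 0)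
  - kap wA wB f g 1 1 1 0 * (Hb2 wA wB h 1 0 - Hb2 wA wB h 0 0)
/-- `Hpart` at the corner `(0,1)`. -/
def Hpart01 : ℝ := chi wA wB f g * Hb2 wA wB h 0 1 + kap wA wB f g 0 1 0 0 * (Hb2 wA wB h 1 1 - Hb2 wA wB h 0 1)
  - kap wA wB f g 1 1 0 1 * (Hb2 wA wB h 0 1 - Hb2 wA wB h 0 0)
/-- `Hpart` at the corner `(0,0)`. -/
def Hpart00 : ℝ := chi wA wB f g * Hb2 wA wB h 0 0 + kap wA wB f g 1 0 0 0 * (Hb2 wA wB h 0 1 - Hb2 wA wB h 0 0)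
  + kap wA wB f g 0 1 0 0 * (Hb2 wA wB h 1 0 - Hb2 wA wB h 0 0)

variable (ρ : Fin 2 → Fin 2 → ℝ)

/-- The antipodal fibre sum `S^ρ(b)` with point-dependent `H`. -/
def Sbox2 (b : β) : ℝ :=
  g 1 1 b * ((2 - ρ 1 1) * Ysl2 wA f h 1 1 b - Fm wA f 0 0 * Hsl2 wA h 1 1 b - (1 - ρ 0 0) * Ysl2 wA f h 0 0 b)
  + g 1 0 b * ((2 - ρ 1 0) * Ysl2 wA f h 1 0 b - Fm wA f 0 1 * Hsl2 wA h 1 0 b - (1 - ρ 0 1) * Ysl2 wA f h 0 1 b)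
  + g 0 1 b * ((2 - ρ 0 1) * Ysl2 wA f h 0 1 b - Fm wA f 1 0 * Hsl2 wA h 0 1 b - (1 - ρ 1 0) * Ysl2 wA f h 1 0 b)
  + g 0 0 b * ((2 - ρ 0 0) * Ysl2 wA f h 0 0 b - Fm wA f 1 1 * Hsl2 wA h 0 0 b - (1 - ρ 1 1) * Ysl2 wA f h 1 1 b)

/-- The covariance part `CP(ρ) = Σ_x [ρ_x Cov(g_x,Y_x) + (1−ρ_x) Cov(g_x̄,Y_x)]`. -/
def CPart2 : ℝ :=
  ρ 1 1 * cov2 wA wB f g h 1 1 1 1 + (1 - ρ 1 1) * cov2 wA wB f g h 0 0 1 1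
  + ρ 1 0 * cov2 wA wB f g h 1 0 1 0 + (1 - ρ 1 0) * cov2 wA wB f g h 0 1 1 0
  + ρ 0 1 * cov2 wA wB f g h 0 1 0 1 + (1 - ρ 0 1) * cov2 wA wB f g h 1 0 0 1
  + ρ 0 0 * cov2 wA wB f g h 0 0 0 0 + (1 - ρ 0 0) * cov2 wA wB f g h 1 1 0 0

/-- The `ρ`-linear remainder `Σ_x ρ_x (G_x − G_x̄) Ȳ_x` (before subtracting `Hpart_κ`). -/
def Rlin : ℝ :=
  ρ 1 1 * (gm wB g 1 1 - gm wB g 0 0) * Ybar2 wA wB f h 1 1 + ρ 0 0 * (gm wB g 0 0 - gm wB g 1 1) * Ybar2 wA wB f h 0 0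
  + ρ 1 0 * (gm wB g 1 0 - gm wB g 0 1) * Ybar2 wA wB f h 1 0 + ρ 0 1 * (gm wB g 0 1 - gm wB g 1 0) * Ybar2 wA wB f h 0 1

end Defs

section Identity

variable {α β : Type} [Fintype α] [Fintype β]
  {wA : α → ℝ} {wB : β → ℝ} {f : Fin 2 → Fin 2 → α → ℝ} {g : Fin 2 → Fin 2 → β → ℝ} {h : Fin 2 → Fin 2 → α → β → ℝ}
  {ρ : Fin 2 → Fin 2 → ℝ}

/-- `Σ_b wB S^ρ(b)` in the mixed moments. -/
theorem sum_Sbox2 :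
    (∑ b, wB b * Sbox2 wA f g h ρ b) =
      (2 - ρ 1 1) * M2 wA wB f g h 1 1 1 1 - Fm wA f 0 0 * N2 wA wB g h 1 1 - (1 - ρ 0 0) * M2 wA wB f g h 1 1 0 0
      + ((2 - ρ 1 0) * M2 wA wB f g h 1 0 1 0 - Fm wA f 0 1 * N2 wA wB g h 1 0 - (1 - ρ 0 1) * M2 wA wB f g h 1 0 0 1)
      + ((2 - ρ 0 1) * M2 wA wB f g h 0 1 0 1 - Fm wA f 1 0 * N2 wA wB g h 0 1 - (1 - ρ 1 0) * M2 wA wB f g h 0 1 1 0)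
      + ((2 - ρ 0 0) * M2 wA wB f g h 0 0 0 0 - Fm wA f 1 1 * N2 wA wB g h 0 0 - (1 - ρ 1 1) * M2 wA wB f g h 0 0 1 1) := by
  have e : ∀ b, wB b * Sbox2 wA f g h ρ b =
      (2 - ρ 1 1) * (wB b * (g 1 1 b * Ysl2 wA f h 1 1 b)) - Fm wA f 0 0 * (wB b * (g 1 1 b * Hsl2 wA h 1 1 b))
        - (1 - ρ 0 0) * (wB b * (g 1 1 b * Ysl2 wA f h 0 0 b))
      + ((2 - ρ 1 0) * (wB b * (g 1 0 b * Ysl2 wA f h 1 0 b)) - Fm wA f 0 1 * (wB b * (g 1 0 b * Hsl2 wA h 1 0 b))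
        - (1 - ρ 0 1) * (wB b * (g 1 0 b * Ysl2 wA f h 0 1 b)))
      + ((2 - ρ 0 1) * (wB b * (g 0 1 b * Ysl2 wA f h 0 1 b)) - Fm wA f 1 0 * (wB b * (g 0 1 b * Hsl2 wA h 0 1 b))
        - (1 - ρ 1 0) * (wB b * (g 0 1 b * Ysl2 wA f h 1 0 b)))
      + ((2 - ρ 0 0) * (wB b * (g 0 0 b * Ysl2 wA f h 0 0 b)) - Fm wA f 1 1 * (wB b * (g 0 0 b * Hsl2 wA h 0 0 b))
        - (1 - ρ 1 1) * (wB b * (g 0 0 b * Ysl2 wA f h 1 1 b))) := fun b => by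
    unfold Sbox2; ring
  simp only [e, sum_add_distrib, sum_sub_distrib, ← mul_sum]
  rfl

/-- **THE BOX IDENTITY** (every `ρ`, no hypothesis): `Main = Σ_b wB S^ρ(b) + CP(ρ) + Σ_x ρ_x(G_x−G_x̄)Ȳ_x`. -/
theorem main_eq_square (ρ : Fin 2 → Fin 2 → ℝ) :
    Main wA wB f g h = (∑ b, wB b * Sbox2 wA f g h ρ b) + CPart2 wA wB f g h ρ + Rlin wA wB f g h ρ := by
  rw [sum_Sbox2]; unfold Main CPart2 cov2 Rlin; ring

/-- Corner `(1,1)`: `Rlin − Hpart_11` in the `D_T0 / D_ZC` form (`a = G_T−G_0`, `d = G_Z−G_C`, with `ρ_0`'s term kept). -/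
theorem R11_eq (ρ : Fin 2 → Fin 2 → ℝ) :
    Rlin wA wB f g h ρ - Hpart11 wA wB f g h =
      (gm wB g 1 1 - gm wB g 0 0) * (ρ 1 1 * Ybar2 wA wB f h 1 1 - ρ 0 0 * Ybar2 wA wB f h 0 0
          - (Fm wA f 1 1 - Fm wA f 0 0) * Hb2 wA wB h 1 1)
      + (gm wB g 1 0 - gm wB g 0 1) * (ρ 1 0 * Ybar2 wA wB f h 1 0 - ρ 0 1 * Ybar2 wA wB f h 0 1
          - (Fm wA f 1 0 - Fm wA f 0 1) * Hb2 wA wB h 1 1)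
      + (Fm wA f 1 1 - Fm wA f 1 0) * (gm wB g 1 1 - gm wB g 1 0) * (Hb2 wA wB h 1 1 - Hb2 wA wB h 0 1)
      + (Fm wA f 1 1 - Fm wA f 0 1) * (gm wB g 1 1 - gm wB g 0 1) * (Hb2 wA wB h 1 1 - Hb2 wA wB h 1 0) := by
  unfold Rlin Hpart11 chi kap; ring

/-- Corner `(1,0)`. -/
theorem R10_eq (ρ : Fin 2 → Fin 2 → ℝ) :
    Rlin wA wB f g h ρ - Hpart10 wA wB f g h =
      (gm wB g 1 1 - gm wB g 0 0) * (ρ 1 1 * Ybar2 wA wB f h 1 1 - ρ 0 0 * Ybar2 wA wB f h 0 0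
          - (Fm wA f 1 1 - Fm wA f 0 0) * Hb2 wA wB h 1 0)
      + (gm wB g 1 0 - gm wB g 0 1) * (ρ 1 0 * Ybar2 wA wB f h 1 0 - ρ 0 1 * Ybar2 wA wB f h 0 1
          - (Fm wA f 1 0 - Fm wA f 0 1) * Hb2 wA wB h 1 0)
      - (Fm wA f 1 0 - Fm wA f 0 0) * (gm wB g 1 0 - gm wB g 0 0) * (Hb2 wA wB h 1 1 - Hb2 wA wB h 1 0)
      + (Fm wA f 1 1 - Fm wA f 1 0) * (gm wB g 1 1 - gm wB g 1 0) * (Hb2 wA wB h 1 0 - Hb2 wA wB h 0 0) := by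
  unfold Rlin Hpart10 chi kap; ring

/-- Corner `(0,1)`. -/
theorem R01_eq (ρ : Fin 2 → Fin 2 → ℝ) :
    Rlin wA wB f g h ρ - Hpart01 wA wB f g h =
      (gm wB g 1 1 - gm wB g 0 0) * (ρ 1 1 * Ybar2 wA wB f h 1 1 - ρ 0 0 * Ybar2 wA wB f h 0 0
          - (Fm wA f 1 1 - Fm wA f 0 0) * Hb2 wA wB h 0 1)
      + (gm wB g 1 0 - gm wB g 0 1) * (ρ 1 0 * Ybar2 wA wB f h 1 0 - ρ 0 1 * Ybar2 wA wB f h 0 1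
          - (Fm wA f 1 0 - Fm wA f 0 1) * Hb2 wA wB h 0 1)
      - (Fm wA f 0 1 - Fm wA f 0 0) * (gm wB g 0 1 - gm wB g 0 0) * (Hb2 wA wB h 1 1 - Hb2 wA wB h 0 1)
      + (Fm wA f 1 1 - Fm wA f 0 1) * (gm wB g 1 1 - gm wB g 0 1) * (Hb2 wA wB h 0 1 - Hb2 wA wB h 0 0) := by
  unfold Rlin Hpart01 chi kap; ring

/-- Corner `(0,0)`. -/
theorem R00_eq (ρ : Fin 2 → Fin 2 → ℝ) :
    Rlin wA wB f g h ρ - Hpart00 wA wB f g h =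
      (gm wB g 1 1 - gm wB g 0 0) * (ρ 1 1 * Ybar2 wA wB f h 1 1 - ρ 0 0 * Ybar2 wA wB f h 0 0
          - (Fm wA f 1 1 - Fm wA f 0 0) * Hb2 wA wB h 0 0)
      + (gm wB g 1 0 - gm wB g 0 1) * (ρ 1 0 * Ybar2 wA wB f h 1 0 - ρ 0 1 * Ybar2 wA wB f h 0 1
          - (Fm wA f 1 0 - Fm wA f 0 1) * Hb2 wA wB h 0 0)
      - (Fm wA f 1 0 - Fm wA f 0 0) * (gm wB g 1 0 - gm wB g 0 0) * (Hb2 wA wB h 0 1 - Hb2 wA wB h 0 0)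
      - (Fm wA f 0 1 - Fm wA f 0 0) * (gm wB g 0 1 - gm wB g 0 0) * (Hb2 wA wB h 1 0 - Hb2 wA wB h 0 0) := by
  unfold Rlin Hpart00 chi kap; ring

end Identity

section Positivity

variable {α β : Type} [Fintype α] [Fintype β]
  {wA : α → ℝ} {wB : β → ℝ} {f : Fin 2 → Fin 2 → α → ℝ} {g : Fin 2 → Fin 2 → β → ℝ} {h : Fin 2 → Fin 2 → α → β → ℝ}

omit [Fintype β] in
/-- `Y_x(·)` is monotone in `b` when `f ≥ 0` and `h_x(a,·)` is monotone. -/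
theorem Ysl2_mono_b [Preorder β] (hA0 : ∀ a, 0 ≤ wA a) (hf0 : ∀ z₁ z₂ a, 0 ≤ f z₁ z₂ a)
    (hhb : ∀ z₁ z₂ a, Monotone (h z₁ z₂ a)) (z₁ z₂ : Fin 2) : Monotone (Ysl2 wA f h z₁ z₂) := by
  intro b b' hbb
  unfold Ysl2
  exact sum_le_sum fun a _ => mul_le_mul_of_nonneg_left (mul_le_mul_of_nonneg_left (hhb z₁ z₂ a hbb) (hf0 z₁ z₂ a)) (hA0 a)

omit [Fintype β] in
/-- `Y_x(b) ≥ 0`. -/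
theorem Ysl2_nonneg (hA0 : ∀ a, 0 ≤ wA a) (hf0 : ∀ z₁ z₂ a, 0 ≤ f z₁ z₂ a) (hh0 : ∀ z₁ z₂ a b, 0 ≤ h z₁ z₂ a b)
    (z₁ z₂ : Fin 2) (b : β) : 0 ≤ Ysl2 wA f h z₁ z₂ b := by
  unfold Ysl2; exact sum_nonneg fun a _ => mul_nonneg (hA0 a) (mul_nonneg (hf0 z₁ z₂ a) (hh0 z₁ z₂ a b))

/-- `Cov_b(g_x, Y_y) ≥ 0` (FKG on `β`). -/
theorem cov2_nonneg [DistribLattice β] (hB : IsFKGMeasure wB) (hA0 : ∀ a, 0 ≤ wA a)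
    (hf0 : ∀ z₁ z₂ a, 0 ≤ f z₁ z₂ a) (hg0 : ∀ z₁ z₂ b, 0 ≤ g z₁ z₂ b) (hgb : ∀ z₁ z₂, Monotone (g z₁ z₂))
    (hh0 : ∀ z₁ z₂ a b, 0 ≤ h z₁ z₂ a b) (hhb : ∀ z₁ z₂ a, Monotone (h z₁ z₂ a)) (z₁ z₂ y₁ y₂ : Fin 2) :
    0 ≤ cov2 wA wB f g h z₁ z₂ y₁ y₂ := by
  unfold cov2 M2 gm Ybar2
  exact sub_nonneg.2 (fkg_sum hB (hg0 z₁ z₂) (Ysl2_nonneg hA0 hf0 hh0 y₁ y₂) (hgb z₁ z₂) (Ysl2_mono_b hA0 hf0 hhb y₁ y₂))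

/-- **`CP(ρ) ≥ 0` for `ρ ∈ [0,1]⁴`.** -/
theorem CPart2_nonneg [DistribLattice β] (hB : IsFKGMeasure wB) (hA0 : ∀ a, 0 ≤ wA a)
    (hf0 : ∀ z₁ z₂ a, 0 ≤ f z₁ z₂ a) (hg0 : ∀ z₁ z₂ b, 0 ≤ g z₁ z₂ b) (hgb : ∀ z₁ z₂, Monotone (g z₁ z₂))
    (hh0 : ∀ z₁ z₂ a b, 0 ≤ h z₁ z₂ a b) (hhb : ∀ z₁ z₂ a, Monotone (h z₁ z₂ a))
    {ρ : Fin 2 → Fin 2 → ℝ} (hρ0 : ∀ z₁ z₂, 0 ≤ ρ z₁ z₂) (hρ1 : ∀ z₁ z₂, ρ z₁ z₂ ≤ 1) :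
    0 ≤ CPart2 wA wB f g h ρ := by
  have c := cov2_nonneg hB hA0 hf0 hg0 hgb hh0 hhb
  unfold CPart2
  have t : ∀ z₁ z₂ y₁ y₂ y₁' y₂', 0 ≤ ρ z₁ z₂ * cov2 wA wB f g h z₁ z₂ y₁ y₂ + (1 - ρ z₁ z₂) * cov2 wA wB f g h y₁' y₂' y₁ y₂ :=
    fun z₁ z₂ y₁ y₂ y₁' y₂' => add_nonneg (mul_nonneg (hρ0 z₁ z₂) (c _ _ _ _)) (mul_nonneg (sub_nonneg.2 (hρ1 z₁ z₂)) (c _ _ _ _))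
  have := t 1 1 1 1 0 0; have := t 1 0 1 0 0 1; have := t 0 1 0 1 1 0; have := t 0 0 0 0 1 1
  linarith

omit [Fintype β] in
/-- The slice bound `F_x·H_x(b) ≤ Y_x(b)` (Harris on `α` at the fibre `b`). -/
theorem Fm_mul_Hsl2_le_Ysl2 [DistribLattice α] (hA : IsFKGMeasure wA) (hf0 : ∀ z₁ z₂ a, 0 ≤ f z₁ z₂ a)
    (hfa : ∀ z₁ z₂, Monotone (f z₁ z₂)) (hh0 : ∀ z₁ z₂ a b, 0 ≤ h z₁ z₂ a b) (hha : ∀ z₁ z₂ b, Monotone (fun a => h z₁ z₂ a b))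
    (z₁ z₂ : Fin 2) (b : β) : Fm wA f z₁ z₂ * Hsl2 wA h z₁ z₂ b ≤ Ysl2 wA f h z₁ z₂ b := by
  unfold Fm Hsl2 Ysl2
  exact fkg_sum hA (hf0 z₁ z₂) (hh0 z₁ z₂ · b) (hfa z₁ z₂) (hha z₁ z₂ b)

/-- The averaged slice bound `F_x·H̄_x ≤ Ȳ_x`. -/
theorem Fm_mul_Hb2_le_Ybar2 [DistribLattice α] (hA : IsFKGMeasure wA) (hB0 : ∀ b, 0 ≤ wB b) (hf0 : ∀ z₁ z₂ a, 0 ≤ f z₁ z₂ a)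
    (hfa : ∀ z₁ z₂, Monotone (f z₁ z₂)) (hh0 : ∀ z₁ z₂ a b, 0 ≤ h z₁ z₂ a b) (hha : ∀ z₁ z₂ b, Monotone (fun a => h z₁ z₂ a b))
    (z₁ z₂ : Fin 2) : Fm wA f z₁ z₂ * Hb2 wA wB h z₁ z₂ ≤ Ybar2 wA wB f h z₁ z₂ := by
  unfold Hb2 Ybar2; rw [mul_sum]
  exact sum_le_sum fun b _ => by
    rw [mul_left_comm]; exact mul_le_mul_of_nonneg_left (Fm_mul_Hsl2_le_Ysl2 hA hf0 hfa hh0 hha z₁ z₂ b) (hB0 b)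

omit [Fintype β] in
/-- `Y` is monotone on the square at each fibre: `Y_x(b) ≤ Y_y(b)` for `x ≤ y` (from `f_x ≤ f_y`, `h_x ≤ h_y`, all `≥ 0`). -/
theorem Ysl2_mono_pt (hA0 : ∀ a, 0 ≤ wA a) (hf0 : ∀ z₁ z₂ a, 0 ≤ f z₁ z₂ a) (hh0 : ∀ z₁ z₂ a b, 0 ≤ h z₁ z₂ a b)
    {z₁ z₂ y₁ y₂ : Fin 2} (hf : ∀ a, f z₁ z₂ a ≤ f y₁ y₂ a) (hh : ∀ a b, h z₁ z₂ a b ≤ h y₁ y₂ a b) (b : β) :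
    Ysl2 wA f h z₁ z₂ b ≤ Ysl2 wA f h y₁ y₂ b := by
  unfold Ysl2
  exact sum_le_sum fun a _ => mul_le_mul_of_nonneg_left
    (mul_le_mul (hf a) (hh a b) (hh0 _ _ a b) (hf0 _ _ a)) (hA0 a)

omit [Fintype β] in
/-- `H` is monotone on the square at each fibre. -/
theorem Hsl2_mono_pt (hA0 : ∀ a, 0 ≤ wA a) {z₁ z₂ y₁ y₂ : Fin 2} (hh : ∀ a b, h z₁ z₂ a b ≤ h y₁ y₂ a b) (b : β) :
    Hsl2 wA h z₁ z₂ b ≤ Hsl2 wA h y₁ y₂ b := by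
  unfold Hsl2; exact sum_le_sum fun a _ => mul_le_mul_of_nonneg_left (hh a b) (hA0 a)

omit [Fintype β] in
/-- `H_x(b) ≥ 0`. -/
theorem Hsl2_nonneg (hA0 : ∀ a, 0 ≤ wA a) (hh0 : ∀ z₁ z₂ a b, 0 ≤ h z₁ z₂ a b) (z₁ z₂ : Fin 2) (b : β) :
    0 ≤ Hsl2 wA h z₁ z₂ b := by
  unfold Hsl2; exact sum_nonneg fun a _ => mul_nonneg (hA0 a) (hh0 z₁ z₂ a b)

/-- `Ȳ` monotone on the square. -/
theorem Ybar2_mono_pt (hA0 : ∀ a, 0 ≤ wA a) (hB0 : ∀ b, 0 ≤ wB b) (hf0 : ∀ z₁ z₂ a, 0 ≤ f z₁ z₂ a)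
    (hh0 : ∀ z₁ z₂ a b, 0 ≤ h z₁ z₂ a b) {z₁ z₂ y₁ y₂ : Fin 2} (hf : ∀ a, f z₁ z₂ a ≤ f y₁ y₂ a)
    (hh : ∀ a b, h z₁ z₂ a b ≤ h y₁ y₂ a b) : Ybar2 wA wB f h z₁ z₂ ≤ Ybar2 wA wB f h y₁ y₂ := by
  unfold Ybar2; exact sum_le_sum fun b _ => mul_le_mul_of_nonneg_left (Ysl2_mono_pt hA0 hf0 hh0 hf hh b) (hB0 b)

/-- `H̄` monotone on the square. -/
theorem Hb2_mono_pt (hA0 : ∀ a, 0 ≤ wA a) (hB0 : ∀ b, 0 ≤ wB b) {z₁ z₂ y₁ y₂ : Fin 2}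
    (hh : ∀ a b, h z₁ z₂ a b ≤ h y₁ y₂ a b) : Hb2 wA wB h z₁ z₂ ≤ Hb2 wA wB h y₁ y₂ := by
  unfold Hb2; exact sum_le_sum fun b _ => mul_le_mul_of_nonneg_left (Hsl2_mono_pt hA0 hh b) (hB0 b)

end Positivity

end SahiT2Square

end Summit.CriticalPhenomena.PercolationContinuityZ3.Theorems
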